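import Summits.HodgeConjecture.HodgeConjecture.Theorems.R90S4OneDimCarrierHOfNotExcluded   -- ★ p863591 (this seat): `isCarrierH_singleton_ofChar_nonsplit_of_notExcluded` (hypothesis-first (APKT-i)); brings ★ p863330 (LK-1D), ★ p863517 (U-ns)
import Summits.HodgeConjecture.HodgeConjecture.Theorems.R90S4OneDimNotExcludedPSMember    -- ★ (EXC-1D) (R90-C131-p01 (g2)): `not_isExcludedPSMember_mk_ofChar`, `…_semilocalComponent`
import HarnessLib

/-!
# R90-TF · S4 (Ch. 13.1–2) · (APKT-i) — «`{⟦ℂ_ξ⟧}` IS A CARRIER at a non-split place», UNCONDITIONAL: LC-APKT clause (i) of FILE A assembled from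
# ★ (LK-1D) p863330, ★ (EXC-1D) (R90-C131-p01), ★ (U-ns) p863517 (Rogawski 1990 §13.1 Thm. 13.1.1 (2)–(3) p. 198, p. 199 ¶3, Prop. 13.1.4 p. 199)

Cell `hodgecm-mathlib`, crux H413 (`stmt-HodgeConjecture-24833`, lane `--supports … --as helper`, count-neutral), route of record `HCCMUnconditional`;
programme R90-TF (brief `director/R90-BRIEF.v2.md` 1f40d54518340a35), section S4 = Rogawski Ch. 13.1–2 (base `R90-C131`), RULINGS S4-R19 (3) ∕ S4-R24 (1) ∕ dealer
00:23:44Z (the sequel of the hypothesis-first ★ p863591); hand R90-C131-p04 (g2).  THEOREMS ONLY (no definition, no instance, no notation, no named fact, no `sorry`);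
★-only imports; no `Lines` import (L9: FILE A's `IsCarrierH` :155 ∕ FILE B's `IsRogPacketH` :230, `IsExcludedPSMember` :353 met by their UNFOLDED bodies, byte for byte).

WHAT.  `IsCarrierH L v μ {⟦ℂ_ξ⟧} := IsRogPacketH L v {⟦ℂ_ξ⟧} ∧ ¬ IsExceptionalH L v μ {⟦ℂ_ξ⟧} ∧ ∃ σ ∈ {⟦ℂ_ξ⟧}, σ.IsUnitarizable` (A :155) for a smooth character `ξ` of
`H_v = U(Φ₂)(L⁺_v) × U(Φ₁)(L⁺_v)` at a NON-SPLIT `v`, now with the (EXC-1D) letter DISCHARGED by ★ `not_isExcludedPSMember_mk_ofChar` (R90-C131-p01 (g2): a one-dimensional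
class is never a constituent of an excluded principal series `i_H(‖·‖^{±1} μ⁻¹, χ₂)` for `μ` continuous and unitary — two-exponent Jacquet argument):
* §1 `isCarrierH_singleton_ofChar_nonsplit (L) (v) (hns) (μ) (hμc) (hμu) (ξ) (hξ)` — abstract currency: `μ : (L ⊗ L⁺_v)^× →* ℂˣ` continuous with `‖μ‖ = 1`;
* §1 `isCarrierH_singleton_ofChar_semilocalComponent (L) (v) (hns) (μω) (hμu) (ξ) (hξ)` — FILE A's currency `μ := μω.semilocalComponent L v` (= A's `muLoc L v μω`,
  an `abbrev`) for a UNITARY Hecke character `μω` (A's frame binder `hμu : μω.IsUnitary`), so that A ED. 5's `stub_R90_S4_lc_aPkt_carrier` is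
  `:= isCarrierH_singleton_ofChar_semilocalComponent L v hv μω hμu ξ hξ` BY NAME (the other frame binders of `_lc_aPkt` are not needed).
Both are ★ p863591 `isCarrierH_singleton_ofChar_nonsplit_of_notExcluded` with `hexc` := the ★ (EXC-1D) head.

HONEST LABEL: count-neutral helper (lane `--supports`); it pays clause (i) of ONE of the five open `_lc_*` laws of FILE A (`stub_R90_S4_lc_aPkt`), and only once an A edition
folds it; clause (ii) of LC-APKT («at most one supercuspidal class in the A-fibre») and LC-CARD ∕ SIGN ∕ OVERLAP ∕ UNRAM are GLOBAL (§13.8) and untouched.  HC_CM is proved only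
modulo the 7 printed citations (2 remaining named inputs: hLiu418 = `stmt-HodgeConjecture-24832`, h413 = `stmt-HodgeConjecture-24833`) until rung 0 closes.  REL ≠ ★ ≠ BUILT.

## References
* [Rogawski1990] J. D. Rogawski, *Automorphic Representations of Unitary Groups in Three Variables*, Ann. of Math. Stud. 123 (1990): §13.1 Thm. 13.1.1 (2)–(3) p. 198,
  p. 199 ¶3, Prop. 13.1.4 p. 199; §12.1 p. 171; §12.2 p. 173 (the excluded principal series); §4.8 p. 51 (the fixed unitary `μ`).
* [BushnellHenniart2006] C. J. Bushnell, G. Henniart, *The Local Langlands Conjecture for GL(2)* (2006), §1.5, §11.1.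
-/

set_option autoImplicit false
-- the mandated namespace repeats the single-problem summit's segment (`HodgeConjecture.HodgeConjecture`)
set_option linter.dupNamespace false

noncomputable section

open NumberField IsDedekindDomain Matrix Topology
open Literature.NumberTheory.Automorphic Literature.NumberTheory.Automorphic.UnitaryGroup
open Literature.NumberTheory.Rogawski1990
open Literature.NumberTheory.GaloisRepresentations (HeckeCharacter)
open scoped MatrixGroups

namespace Summit.HodgeConjecture.HodgeConjecture.R90.S4

variable (L : Type) [Field L] [NumberField L] [IsCMField L] (v : HeightOneSpectrum (𝓞 ↥(maximalRealSubfield L)))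
  (hns : ∀ w : PlacesOver L v, IsCMField.complexConj L • w.1 = w.1)

/-! ## §1 (APKT-i), unconditional -/

include hns in
/-- **(APKT-i) — `IsCarrierH L v μ {⟦ℂ_ξ⟧}` (FILE A :155, UNFOLDED) at a non-split `v`**, for `μ : (L ⊗ L⁺_v)^× →* ℂˣ` continuous and unitary and any smooth character `ξ` of
`H_v`: ★ p863591 with the (EXC-1D) letter discharged by ★ `not_isExcludedPSMember_mk_ofChar`. [cite: Rogawski1990, §13.1 Thm. 13.1.1 (2)–(3) p. 198, p. 199 ¶3; §12.1 p. 171] -/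
theorem isCarrierH_singleton_ofChar_nonsplit
    (μ : (LocalRing L v)ˣ →* ℂˣ) (hμc : Continuous fun x => ((μ x : ℂˣ) : ℂ)) (hμu : ∀ x, ‖((μ x : ℂˣ) : ℂ)‖ = 1)
    (ξ : ((cmDatum L 2 (Matrix.of fun i j : Fin 2 => if i.val + j.val + 1 = 2 then (1 : L) else 0)).Local v ×
      (cmDatum L 1 (Matrix.of fun i j : Fin 1 => if i.val + j.val + 1 = 1 then (1 : L) else 0)).Local v) →* ℂˣ)
    (hξ : IsOpen ((ξ.ker : Subgroup ((cmDatum L 2 (Matrix.of fun i j : Fin 2 => if i.val + j.val + 1 = 2 then (1 : L) else 0)).Local v ×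
      (cmDatum L 1 (Matrix.of fun i j : Fin 1 => if i.val + j.val + 1 = 1 then (1 : L) else 0)).Local v)) :
        Set ((cmDatum L 2 (Matrix.of fun i j : Fin 2 => if i.val + j.val + 1 = 2 then (1 : L) else 0)).Local v ×
      (cmDatum L 1 (Matrix.of fun i j : Fin 1 => if i.val + j.val + 1 = 1 then (1 : L) else 0)).Local v))) :
    -- `IsRogPacketH L v {⟦ℂ_ξ⟧}`, unfolded
    (∃ (O : Finset (IrrClass ((cmDatum L 2 (Matrix.of fun i j : Fin 2 => if i.val + j.val + 1 = 2 then (1 : L) else 0)).Local v)))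
        (χ : (cmDatum L 1 (Matrix.of fun i j : Fin 1 => if i.val + j.val + 1 = 1 then (1 : L) else 0)).Local v →* ℂˣ)
        (hχ : IsOpen ((χ.ker : Subgroup ((cmDatum L 1 (Matrix.of fun i j : Fin 1 => if i.val + j.val + 1 = 1 then (1 : L) else 0)).Local v)) :
          Set ((cmDatum L 1 (Matrix.of fun i j : Fin 1 => if i.val + j.val + 1 = 1 then (1 : L) else 0)).Local v))),
        (∃ σ : IrrClass ((cmDatum L 2 (Matrix.of fun i j : Fin 2 => if i.val + j.val + 1 = 2 then (1 : L) else 0)).Local v),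
          σ.IsAdmissible ∧ ∀ c, c ∈ O ↔
            ∃ (T : GL (Fin 2) (LocalRing L v)) (a : LocalRing L v) (ha : IsUnit a)
              (h : formCongr (conjLocal L (IsCMField.complexConj L) v) T
                  ((Matrix.of fun i j : Fin 2 => if i.val + j.val + 1 = 2 then (1 : L) else 0).map (algebraMap L (LocalRing L v))) =
                a • (Matrix.of fun i j : Fin 2 => if i.val + j.val + 1 = 2 then (1 : L) else 0).map (algebraMap L (LocalRing L v))),
              c = IrrClass.comap (cmDatumLocalCongr L v T ha h) σ) ∧
        ({IrrClass.mk (SmoothIrrep.ofChar ξ hξ)} :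
            Finset (IrrClass ((cmDatum L 2 (Matrix.of fun i j : Fin 2 => if i.val + j.val + 1 = 2 then (1 : L) else 0)).Local v ×
              (cmDatum L 1 (Matrix.of fun i j : Fin 1 => if i.val + j.val + 1 = 1 then (1 : L) else 0)).Local v))) =
          O.map ⟨IrrClass.boxChar χ hχ, IrrClass.boxChar_injective χ hχ⟩) ∧
    -- `¬ IsExceptionalH L v μ {⟦ℂ_ξ⟧}`, unfolded
    (¬ ∃ σ ∈ ({IrrClass.mk (SmoothIrrep.ofChar ξ hξ)} :
          Finset (IrrClass ((cmDatum L 2 (Matrix.of fun i j : Fin 2 => if i.val + j.val + 1 = 2 then (1 : L) else 0)).Local v ×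
            (cmDatum L 1 (Matrix.of fun i j : Fin 1 => if i.val + j.val + 1 = 1 then (1 : L) else 0)).Local v))),
      ∃ (χ₁ : (LocalRing L v)ˣ →* ℂˣ) (χ₂ : ↥(normOneUnits (conjLocal L (IsCMField.complexConj L) v)) →* ℂˣ),
        (χ₁ = halfModulusChar (LocalRing L v) ^ 2 * μ⁻¹ ∨ χ₁ = (halfModulusChar (LocalRing L v) ^ 2)⁻¹ * μ⁻¹) ∧
        IsOpen ((χ₂.ker : Subgroup ↥(normOneUnits (conjLocal L (IsCMField.complexConj L) v))) :
          Set ↥(normOneUnits (conjLocal L (IsCMField.complexConj L) v))) ∧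
        σ.IsConstituentOf
          (cmPrincipalSeriesH L v
            (torusCharPair (conjLocal L (IsCMField.complexConj L) v) (cmLocalForm L 2 v) (cmLocalForm_eq_over L 2 v) 0 χ₁ χ₂)
            (χ₂.comp (localDet (IsCMField.complexConj L) v (isUnit_antidiagOne_det L 1))))) ∧
    -- `∃ σ ∈ {⟦ℂ_ξ⟧}, σ.IsUnitarizable`
    (∃ σ ∈ ({IrrClass.mk (SmoothIrrep.ofChar ξ hξ)} :
          Finset (IrrClass ((cmDatum L 2 (Matrix.of fun i j : Fin 2 => if i.val + j.val + 1 = 2 then (1 : L) else 0)).Local v ×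
            (cmDatum L 1 (Matrix.of fun i j : Fin 1 => if i.val + j.val + 1 = 1 then (1 : L) else 0)).Local v))),
      σ.IsUnitarizable) :=
  isCarrierH_singleton_ofChar_nonsplit_of_notExcluded L v hns μ ξ hξ (not_isExcludedPSMember_mk_ofChar L v hns μ hμc hμu ξ hξ)

include hns in
/-- **(APKT-i) IN FILE A's CURRENCY — `IsCarrierH L v (muLoc L v μω) {⟦ℂ_ξ⟧}` (UNFOLDED; `muLoc L v μω = μω.semilocalComponent L v`) at a non-split `v`** for a UNITARY Hecke
character `μω` (A's frame binder `hμu : μω.IsUnitary`) and any smooth character `ξ` of `H_v`: the fold for A ED. 5's `stub_R90_S4_lc_aPkt_carrier`.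
★ p863591 with ★ `not_isExcludedPSMember_mk_ofChar_semilocalComponent`. [cite: Rogawski1990, §13.1 Thm. 13.1.1 (2)–(3) p. 198, Prop. 13.1.4 p. 199; §4.8 p. 51] -/
theorem isCarrierH_singleton_ofChar_semilocalComponent
    (μω : HeckeCharacter L) (hμu : μω.IsUnitary)
    (ξ : ((cmDatum L 2 (Matrix.of fun i j : Fin 2 => if i.val + j.val + 1 = 2 then (1 : L) else 0)).Local v ×
      (cmDatum L 1 (Matrix.of fun i j : Fin 1 => if i.val + j.val + 1 = 1 then (1 : L) else 0)).Local v) →* ℂˣ)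
    (hξ : IsOpen ((ξ.ker : Subgroup ((cmDatum L 2 (Matrix.of fun i j : Fin 2 => if i.val + j.val + 1 = 2 then (1 : L) else 0)).Local v ×
      (cmDatum L 1 (Matrix.of fun i j : Fin 1 => if i.val + j.val + 1 = 1 then (1 : L) else 0)).Local v)) :
        Set ((cmDatum L 2 (Matrix.of fun i j : Fin 2 => if i.val + j.val + 1 = 2 then (1 : L) else 0)).Local v ×
      (cmDatum L 1 (Matrix.of fun i j : Fin 1 => if i.val + j.val + 1 = 1 then (1 : L) else 0)).Local v))) :
    -- `IsRogPacketH L v {⟦ℂ_ξ⟧}`, unfolded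
    (∃ (O : Finset (IrrClass ((cmDatum L 2 (Matrix.of fun i j : Fin 2 => if i.val + j.val + 1 = 2 then (1 : L) else 0)).Local v)))
        (χ : (cmDatum L 1 (Matrix.of fun i j : Fin 1 => if i.val + j.val + 1 = 1 then (1 : L) else 0)).Local v →* ℂˣ)
        (hχ : IsOpen ((χ.ker : Subgroup ((cmDatum L 1 (Matrix.of fun i j : Fin 1 => if i.val + j.val + 1 = 1 then (1 : L) else 0)).Local v)) :
          Set ((cmDatum L 1 (Matrix.of fun i j : Fin 1 => if i.val + j.val + 1 = 1 then (1 : L) else 0)).Local v))),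
        (∃ σ : IrrClass ((cmDatum L 2 (Matrix.of fun i j : Fin 2 => if i.val + j.val + 1 = 2 then (1 : L) else 0)).Local v),
          σ.IsAdmissible ∧ ∀ c, c ∈ O ↔
            ∃ (T : GL (Fin 2) (LocalRing L v)) (a : LocalRing L v) (ha : IsUnit a)
              (h : formCongr (conjLocal L (IsCMField.complexConj L) v) T
                  ((Matrix.of fun i j : Fin 2 => if i.val + j.val + 1 = 2 then (1 : L) else 0).map (algebraMap L (LocalRing L v))) =
                a • (Matrix.of fun i j : Fin 2 => if i.val + j.val + 1 = 2 then (1 : L) else 0).map (algebraMap L (LocalRing L v))),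
              c = IrrClass.comap (cmDatumLocalCongr L v T ha h) σ) ∧
        ({IrrClass.mk (SmoothIrrep.ofChar ξ hξ)} :
            Finset (IrrClass ((cmDatum L 2 (Matrix.of fun i j : Fin 2 => if i.val + j.val + 1 = 2 then (1 : L) else 0)).Local v ×
              (cmDatum L 1 (Matrix.of fun i j : Fin 1 => if i.val + j.val + 1 = 1 then (1 : L) else 0)).Local v))) =
          O.map ⟨IrrClass.boxChar χ hχ, IrrClass.boxChar_injective χ hχ⟩) ∧
    -- `¬ IsExceptionalH L v μ {⟦ℂ_ξ⟧}`, unfolded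
    (¬ ∃ σ ∈ ({IrrClass.mk (SmoothIrrep.ofChar ξ hξ)} :
          Finset (IrrClass ((cmDatum L 2 (Matrix.of fun i j : Fin 2 => if i.val + j.val + 1 = 2 then (1 : L) else 0)).Local v ×
            (cmDatum L 1 (Matrix.of fun i j : Fin 1 => if i.val + j.val + 1 = 1 then (1 : L) else 0)).Local v))),
      ∃ (χ₁ : (LocalRing L v)ˣ →* ℂˣ) (χ₂ : ↥(normOneUnits (conjLocal L (IsCMField.complexConj L) v)) →* ℂˣ),
        (χ₁ = halfModulusChar (LocalRing L v) ^ 2 * (μω.semilocalComponent L v)⁻¹ ∨ χ₁ = (halfModulusChar (LocalRing L v) ^ 2)⁻¹ * (μω.semilocalComponent L v)⁻¹) ∧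
        IsOpen ((χ₂.ker : Subgroup ↥(normOneUnits (conjLocal L (IsCMField.complexConj L) v))) :
          Set ↥(normOneUnits (conjLocal L (IsCMField.complexConj L) v))) ∧
        σ.IsConstituentOf
          (cmPrincipalSeriesH L v
            (torusCharPair (conjLocal L (IsCMField.complexConj L) v) (cmLocalForm L 2 v) (cmLocalForm_eq_over L 2 v) 0 χ₁ χ₂)
            (χ₂.comp (localDet (IsCMField.complexConj L) v (isUnit_antidiagOne_det L 1))))) ∧
    -- `∃ σ ∈ {⟦ℂ_ξ⟧}, σ.IsUnitarizable`
    (∃ σ ∈ ({IrrClass.mk (SmoothIrrep.ofChar ξ hξ)} :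
          Finset (IrrClass ((cmDatum L 2 (Matrix.of fun i j : Fin 2 => if i.val + j.val + 1 = 2 then (1 : L) else 0)).Local v ×
            (cmDatum L 1 (Matrix.of fun i j : Fin 1 => if i.val + j.val + 1 = 1 then (1 : L) else 0)).Local v))),
      σ.IsUnitarizable) :=
  isCarrierH_singleton_ofChar_nonsplit_of_notExcluded L v hns (μω.semilocalComponent L v) ξ hξ
    (not_isExcludedPSMember_mk_ofChar_semilocalComponent L v hns μω hμu ξ hξ)

end Summit.HodgeConjecture.HodgeConjecture.R90.S4

end
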